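import Literature.MathematicalPhysics.QuantumFieldTheory.Balaban1983to89.B8Thm4ExistsConcreteGamma
import Literature.MathematicalPhysics.QuantumFieldTheory.Balaban1983to89.B8Thm4ConcreteBdryBeta
import Literature.MathematicalPhysics.QuantumFieldTheory.Balaban1983to89.B8LeafModelZd3P
import Literature.MathematicalPhysics.QuantumFieldTheory.Balaban1983to89.B8Eq142KLevelLocalGammaPrime
import Literature.MathematicalPhysics.QuantumFieldTheory.Balaban1983to89.B8Ineq166OneLevelUp
import Literature.MathematicalPhysics.QuantumFieldTheory.Balaban1983to89.B8Prop7GlevZd3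
import Literature.MathematicalPhysics.QuantumFieldTheory.Balaban1983to89.B8Ineq165AllLevels

/-!
# `Balaban1983to89.B8Thm4Zd3Gamma` — [Balaban1985RegularSpaces] THEOREM 4 (p. 88) WHOLE («there exists exactly one gauge transformation»), EDITION γ, ON THE
# `ℤᵈ` CARRIERS: the member-generic body = `pub-ymgap-dag-n05-e`'s γ EXISTENCE `B8Thm4ExistsConcreteGamma.thm4Exists_concrete_uniform_γ` BY NAME ∧ the class-free
# UNIQUENESS tail of `B8Thm4ConcreteBdryBeta` (Proposition 5's uniqueness socket), under one threshold — the (D4) member sentence of the §n05 γ chain; the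
# `zdGF3`-FAMILY packaging (via the one-level-up bridge `B8Ineq166OneLevelUp`) follows as an append-only §2 once the carrier word of record is in

statement-level skeleton of published theorems with citation tags; proofs where landed; nothing here is a claim about the
Yang–Mills mass gap

PDF held: `paper:balaban1985-cmp99-regular-spaces-gauge-fixing` (journal page = PDF page + 74); p. 88 (Theorem 4: *«there exists exactly one gauge transformation u
satisfying (1.29) and such that the conditions (1.37), (1.38), (1.62) hold for the configuration U₁ = U′^{u⁻¹}»*), p. 95 (the uniqueness paragraph: *«From (64)–(87)
of [3] it follows that u₁ is determined uniquely …»*, Proposition 5's (1.109)), pp. 81–83 ((1.29), (1.31), (1.35)–(1.38)), pp. 86–87 ((1.58)–(1.62), (1.66)), p. 94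
(Prop. 5) — read first-hand this session (pp. 77, 82–83, 87–88).

CITATION HEADER (lean-in-tree rule).  Cell `pub-ymgap` (HUMAN RULING D-0062 ∕ D-0149, Track A), DAG node N05 = [B8], width seat `pub-ymgap-dag-n05-w2` (g0), key K1⁷
`stmt-QuantumFields-20542` (helper, count-neutral); plan g77 W-SEAT-START-LIST v3 § n05 (w2 = D5 + D4), dag-lead g13 DEDUP-354 (1) (path∕name FREE, GO).  WHY THIS FILE.
Edition γ of Theorem 4's driver (`pub-ymgap-dag-n05-e` g9: `B8Eq142KLevelLocalGamma.H42_of_inAx_γ` p580875, `B8Thm4KLevelGamma.thm4_exists_all_levels_supp_landau138_γ`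
p581447, `B8Thm4ExistsConcreteGamma.thm4Exists_concrete_uniform_γ`) reads the (1.59) socket's averaging datum over a PARAMETRIC constraint-bond class `Λb` under
PRINT's law «the box of a level-`j` datum bond lies in `Ω_{j−1}`» ((1.31) p. 82), so that the crossing bonds are admissible data (the «box ⊂ Ω_j» class of the β
edition empties them and is killed by shell gauge modes at nested members: `pub-ymgap-dag-n05-c` `B8Ineq159FlatShellModeVacuity` p572834).  dag-n05-e delivers the
EXISTENCE half member-generically; THIS FILE adds Theorem 4's «exactly one»: §1 ★ `thm4Body_concrete_uniform_γ` = her existence theorem BY NAME ∧ the uniqueness clause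
of `B8Thm4ConcreteBdryBeta.thm4Body_concrete_uniform_bdryβ` (dag-n05-e g8), whose proof reads no class — `B8Thm4SupportLocal.thm4_unique_eq_landau138` (dag-n05-a) on
Proposition 5's uniqueness socket `SP5u`, the towers `htower` and the partition `hpart` of the member — under the smaller of the two thresholds; binder order = the β
body's (`hbox hclass htower hpart hlay SP5base SP5 SH59Dβ SP5u`), so that the member∕family packaging is a token swap of the β one.  Kind «kernel-checked proof»,
theorems only, no `def`.

HONEST SCOPE ∕ A6 (director-ym №189 (3) ∕ №196).  Composition by name; nothing of [4] or of Propositions 3∕5 is proved here.  Every socket is a HYPOTHESIS: `SP5base` ∕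
`SP5` ∕ `SP5u` (Proposition 5 ∃ base ∕ ∃ step ∕ uniqueness — providers in the tree at `Ω₀ = ℤᵈ` members modulo [4]'s letters: `B8SockHFPAssembly`, `B8Prop5SocketsOfHFP`,
`B8SockP5uEAssembly`) and the β-SHAPED two-line (1.59) socket `SH59Dβ` over the SUPPLIED class `Λb` — false over a «box ⊂ Ω_j» class at nested members (p572834),
print's (1.59) = [4] Thm 3.3 over print's class (`cubeLamBP'` ∕ `towerBondsP`; dag-n06-b's γ suppliers `B9SupplySockB9P3ZdGamma(Univ)` p579891 ∕ p580942, A6-witnessed at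
truncation `m = 0`); the datum hypotheses are Theorem 4's frame ((1.33)∕(1.34)∕axial∕(1.35) in the guard «box ⊂ Ω_{j−1}»∕(1.66)₀ — inhabited, e.g. `U′ = 1`, `Λb = ∅`).
No joint-satisfiability claim of the full ∀-m binder list.  `≤` for print's `<`; `T_η ↦ ℤᵈ`; constants the lineage's explicit sufficient ones.  Count-neutral; N05 NOT
discharged; one finite `𝕋⁴` programme at fixed `ε`, Bałaban AS PRINTED; the Yang–Mills mass gap (Clay) is NOT proved by any of this — R4 closes the conditional
finite-`𝕋⁴` rung `BalabanLadder.UV` only; nothing continuum ∕ ℝ⁴ ∕ OS ∕ mass-gap.  No `sorry`, no `def`, no `instance`, no `notation`.  Unit `pub-ymgap-dag-n05-w2` (g0),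
2026-08-27.  Tree API by name only, nothing restated.

RELATED IN THE TREE, NOT DUPLICATED: `B8Thm4ExistsConcreteGamma` (dag-n05-e; USED: the existence half), `B8Thm4ConcreteBdryBeta` (β whole body; its uniqueness block is
re-run here verbatim on the γ existence), `B8Thm4SupportLocal.thm4_unique_eq_landau138` (USED), `B8Thm4Windows` (USED: the uniqueness windows), `B8Ineq166OneLevelUp`
(this seat: the (1.66) one-level-up bridge the §2 family packaging will use), `B8LeafModelZd3.thm4Printed_zd3` (the un-editioned family form).

VERSION v1.1 (same seat, APPEND-ONLY; §1 byte-identical): + §2 ★ `thm4Body_member_zd3P_γ` ∕ ★★ `thm4Printed_zd3P_map_γ` — THEOREM 4 AS PRINTED on the RE-TYPED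
CARRIER `B8LeafModelZd3P.zdGF3P` (`pub-ymgap-dag-n05-w1`: (1.35)∕(1.66) in print's one-end-point class `EndBlockIn`, (1.37)∕(1.42) over print's class `towerBondsP`):
§1 run at the scaled pair `(K·α₀, K·α₁)`, `K = 26384(d+1)L`, the γ driver's (1.35) fed from the member's letter through this seat's one-level-up bridge
`B8Ineq166OneLevelUp.avgClose_predBox_of_boxForm` (p584176), (1.37) on print's class at print's `α₁` by this seat's `B8Eq142KLevelLocalGammaPrime.H42_of_inAx_γ'`
(p587580) fed by the member's letter verbatim; Theorem 4's constant `B₁′ = 5dL·(K·B₀)` («B₁′ = C′₁B₁», d, L only); sockets at `B₀`.  + imports `B8LeafModelZd3P`,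
`B8Eq142KLevelLocalGammaPrime`, `B8Ineq166OneLevelUp`, `B8Prop7GlevZd3`, `B8Ineq165AllLevels`.
-/

noncomputable section

open NormedSpace

namespace Literature.MathematicalPhysics.QuantumFieldTheory.Balaban1983to89.B8Thm4Zd3Gamma

open Complex (I)
open MatrixLog B7Prop1Explicit B7Prop2Explicit B7Prop1Local B7Eq92Concrete
open B7Prop2Explicit (C0 c2')
open B7Prop3Flat (c3)
open B8Ineq132 (covDerivFwd InAk BondTouches)
open B8Eq119TwistedAxial (Restr129 InAx)
open B8Eq184Proof (gaugeExp cfgExp)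
open B8Lemma1NonAbelian (mulCfg)
open B8Eq140Level (SideTouches)
open B8Eq146AExpansion (iEta)
open B7Prop4GeneralLevels (logCovIter linCovIter)
open B8Eq155JBound (Jcur wsup)
open B8ScaledSupNorm (bondNorm msup)
open B8Thm2LogB (blockTop)
open B8Ineq130 (tlo thi)
open B8Eq138LandauZd (IsLandau138W logCfg)
open B8Prop3GaugeFixedKLevel (eq_mgauge_inv_of_mgauge_eq mem_unitaryUnits_of_mgauge_eq logField_spec)
open B8Thm4SupportLocal (thm4_unique_eq_landau138)
open B8Thm4Windows (thm4_windows thm4_windows_extra)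
open B8Thm4AtLandau138 (mgauge_mgauge_inv)
open B8Thm4Concrete (mulCfg_eq_mul)
open B8LeafModelZd (SockP5base SockP5 SockP5u ZdIdx)
open B8LeafModelZd3 (mlogCfg mlogCfg_spec zdGF3)
open B9SupplySockB9P3ZdBeta (CrossB)
open B8Thm4ExistsConcreteGamma (thm4Exists_concrete_uniform_γ)
open B8Thm4ExistsConcreteGamma (thm4_windows_γ)
open B8TowerBondsPrinted (towerBondsP)
open B8LeafModelZd3P (zdGF3P zdGF3HP)
open B8Ineq166OneLevelUp (avgClose_predBox_of_boxForm)
open B8Prop7GlevZd3 (inAk_mono_alpha)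

-- `Site` alone could resolve to the torus sites of `Setup.lean`; re-export the `ℤ^d` sites of `B7Prop1Explicit`.
export B7Prop1Explicit (Site)

variable {d : ℕ}

/-! ## §1 Theorem 4 WHOLE on the `ℤᵈ` carriers, edition γ: existence (n05-e) ∧ the class-free uniqueness tail -/

section Main

variable {𝔸 : Type*} [CStarAlgebra 𝔸] [Nontrivial 𝔸]

/-- ★ **THEOREM 4 (p. 88), EXISTENCE AND UNIQUENESS ON THE `ℤᵈ` CARRIERS, EDITION γ** — `B8Thm4ExistsConcreteGamma.thm4Exists_concrete_uniform_γ`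
(dag-n05-e: ONE threshold; the datum class `Λb` a PARAMETER under print's law «box ⊂ Ω_{j−1}»; the datum's (1.35) in the guard «box ⊂ Ω_{j−1}»; sockets
`SP5base` ∕ `SP5` ∕ the β-shaped (1.59) socket `SH59Dβ` over `Λb`; boundary-layer law `hlay`) ∧ THE UNIQUENESS CLAUSE of `B8Thm4ConcreteBdryBeta.thm4Body_concrete_uniform_bdryβ`
(which reads no class: `B8Thm4SupportLocal.thm4_unique_eq_landau138` on Proposition 5's uniqueness socket `SP5u`, the towers `htower` and the partition `hpart`), under
the smaller of the two thresholds.  Binder order = the β body's (`hbox hclass htower hpart hlay SP5base SP5 SH59Dβ SP5u`).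
[cite: Balaban1985RegularSpaces, Thm 4 p.88 («there exists exactly one»), (1.29) p.81, (1.31) p.82, (1.35)/(1.38) p.82, (1.58)–(1.62) pp.86–87, (1.66) p.87, Prop. 5 (1.107)–(1.109) p.94, p.95] -/
theorem thm4Body_concrete_uniform_γ (hd2 : 2 ≤ d) {L : ℕ} (hL : 2 ≤ L)
    {B₀ B₀' cu cP Bbd : ℝ} (hB₀ : 0 < B₀) (hB₀' : 0 < B₀') (hB : 2 ≤ 5 * (d : ℝ) * L * B₀) (hcu : 0 < cu) (hcP : 0 < cP)
    (hBbd : 0 ≤ Bbd) (hBd : 4 * Bbd ≤ ((d : ℝ) * L - 1) * B₀) :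
    ∃ c₁ : ℝ, 0 < c₁ ∧ ∀ (η : ℝ), 0 < η → ∀ (k : ℕ)
    (Ω : ℕ → Set (Site d)) (hΩ : ∀ j, Ω (j + 1) ⊆ Ω j) (Λs : ℕ → ℕ → Set (Site d)) (Λb : ℕ → ℕ → Set (Site d × Fin d))
    -- PRINT's box law (edition γ): the box of a level-`j` datum bond lies in `Ω_{j−1}` ((1.31); level 0: `Ω₀`)
    (hbox : ∀ m, m ≤ k → ∀ j, j ≤ m → ∀ c ∈ Λb m j, ∀ x, InBox (loK L j c.1) (bondHiK L j c.1 c.2) x → x ∈ Ω (j - 1))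
    (hclass : ∀ m, m ≤ k → ∀ j, j ≤ m → ∀ c ∈ Λb m j,
      (c.1 ∈ Λs m j ∧ c.1 + e c.2 ∈ Λs m j) ∨
      (∃ j', j = j' + 1 ∧ (∀ x, (L : ℤ) • c.1 ≤ x → x ≤ (L : ℤ) • c.1 + blockTop L → x ∈ Λs m j') ∧ c.1 + e c.2 ∈ Λs m j) ∨
      (∃ j', j = j' + 1 ∧ c.1 ∈ Λs m j ∧ (∀ x, (L : ℤ) • (c.1 + e c.2) ≤ x → x ≤ (L : ℤ) • (c.1 + e c.2) + blockTop L → x ∈ Λs m j')))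
    (htower : ∀ j, j ≤ k → ∀ y ∈ Λs k j, ∀ x, InBox (tlo L y j) (thi L y j) x → x ∈ Ω j)
    (hpart : ∀ x, x ∈ Ω 0 → ∃ j, j ≤ k ∧ ∃ y ∈ Λs k j, InBox (tlo L y j) (thi L y j) x)
    (hlay : ∀ m, 1 ≤ m → m ≤ k → ∀ y z : Site d, y ∈ Ω 0 → z ∉ Ω 0 → (∀ i, y i - 1 ≤ z i ∧ z i ≤ y i + 1) → y ∈ Λs m 0)
    (SP5base : ∀ α₀ α₁ : ℝ, 0 < α₀ → 0 < α₁ → α₀ + α₁ ≤ cP →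
      ∀ U₀ U' : Site d → Fin d → 𝔸ˣ, (∀ x κ, U₀ x κ ∈ unitaryUnits 𝔸) → (∀ x κ, U' x κ ∈ unitaryUnits 𝔸) →
      InAk L k η α₀ Ω U₀ → InAk L k η α₀ Ω (mulCfg U' U₀) → (∀ m, m ≤ k → InAx L m (Λs m) U₀ (mulCfg U' U₀)) →
      (∀ j, j ≤ k → ∀ (z : Site d) (μ : Fin d), (∀ x, InBox (loK L j z) (bondHiK L j z μ) x → x ∈ Ω j) →
        ‖(avgIter L (mulCfg U' U₀) j z μ : 𝔸) - (avgIter L U₀ j z μ : 𝔸)‖ ≤ α₁) →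
      (∀ b ∈ {b : Site d × Fin d | SideTouches (Ω 0) b.1 b.2}, ‖((U' b.1 b.2 : 𝔸ˣ) : 𝔸) - 1‖ ≤ α₁) →
      (∃ (v : Site d → 𝔸ˣ) (lam : Site d → 𝔸), (∀ x, v x ∈ unitaryUnits 𝔸) ∧ (∀ x, x ∉ Ω 0 → v x = 1) ∧
        (∀ j, j ≤ 1 → ∀ b ∈ {b : Site d × Fin d | SideTouches (Ω j) b.1 b.2}, (v b.1 : 𝔸) = ((gaugeExp lam b.1 : 𝔸ˣ) : 𝔸) ∧
        (v (b.1 + e b.2) : 𝔸) = ((gaugeExp lam (b.1 + e b.2) : 𝔸ˣ) : 𝔸)) ∧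
        (∀ j, j ≤ 1 → ∀ b ∈ {b : Site d × Fin d | SideTouches (Ω j) b.1 b.2},
        ‖lam b.1‖ ≤ (8 * B₀' * (5 * (d : ℝ) * L * B₀) * (α₀ + α₁)) ∧ ((L : ℝ) ^ j * η) * ‖covDerivFwd η U₀ b.2 lam b.1‖ ≤ (8 * B₀' * (5 * (d : ℝ) * L * B₀) * (α₀ + α₁))) ∧
        IsLandau138W L 1 η (Ω 0) (Λs 1) U₀ (mgauge U₀ v⁻¹ U') ∧ Restr129 L 1 (Λs 1) U₀ ((1 : Site d → 𝔸ˣ) * v)))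
    (SP5 : ∀ α₀ α₁ : ℝ, 0 < α₀ → 0 < α₁ → α₀ + α₁ ≤ cP →
      ∀ U₀ U' : Site d → Fin d → 𝔸ˣ, (∀ x κ, U₀ x κ ∈ unitaryUnits 𝔸) → (∀ x κ, U' x κ ∈ unitaryUnits 𝔸) →
      InAk L k η α₀ Ω U₀ → InAk L k η α₀ Ω (mulCfg U' U₀) → (∀ m, m ≤ k → InAx L m (Λs m) U₀ (mulCfg U' U₀)) →
      (∀ j, j ≤ k → ∀ (z : Site d) (μ : Fin d), (∀ x, InBox (loK L j z) (bondHiK L j z μ) x → x ∈ Ω j) →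
        ‖(avgIter L (mulCfg U' U₀) j z μ : 𝔸) - (avgIter L U₀ j z μ : 𝔸)‖ ≤ α₁) →
      (∀ b ∈ {b : Site d × Fin d | SideTouches (Ω 0) b.1 b.2}, ‖((U' b.1 b.2 : 𝔸ˣ) : 𝔸) - 1‖ ≤ α₁) →
      (∀ m, 1 ≤ m → m < k → ∀ (u₁ : Site d → 𝔸ˣ) (U₁ : Site d → Fin d → 𝔸ˣ) (A : Site d → Fin d → 𝔸),
        (∀ x, u₁ x ∈ unitaryUnits 𝔸) → (∀ x, x ∉ Ω 0 → u₁ x = 1) → mgauge U₀ u₁ U₁ = U' → Restr129 L m (Λs m) U₀ u₁ →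
        IsLandau138W L m η (Ω 0) (Λs m) U₀ U₁ →
        (∀ j, j ≤ m → ∀ b ∈ {b : Site d × Fin d | SideTouches (Ω j) b.1 b.2},
        U₁ b.1 b.2 = cfgExp η A b.1 b.2 ∧ IsSelfAdjoint (A b.1 b.2) ∧ ‖A b.1 b.2‖ ≤ (5 * (d : ℝ) * L * B₀ * (α₀ + α₁)) * ((L : ℝ) ^ j * η)⁻¹) →
        ∃ (v : Site d → 𝔸ˣ) (lam : Site d → 𝔸), (∀ x, v x ∈ unitaryUnits 𝔸) ∧ (∀ x, x ∉ Ω 0 → v x = 1) ∧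
        (∀ j, j ≤ m + 1 → ∀ b ∈ {b : Site d × Fin d | SideTouches (Ω j) b.1 b.2}, (v b.1 : 𝔸) = ((gaugeExp lam b.1 : 𝔸ˣ) : 𝔸) ∧
        (v (b.1 + e b.2) : 𝔸) = ((gaugeExp lam (b.1 + e b.2) : 𝔸ˣ) : 𝔸)) ∧
        (∀ j, j ≤ m + 1 → ∀ b ∈ {b : Site d × Fin d | SideTouches (Ω j) b.1 b.2},
        ‖lam b.1‖ ≤ (8 * B₀' * (5 * (d : ℝ) * L * B₀) * (α₀ + α₁)) ∧ ((L : ℝ) ^ j * η) * ‖covDerivFwd η U₀ b.2 lam b.1‖ ≤ (8 * B₀' * (5 * (d : ℝ) * L * B₀) * (α₀ + α₁))) ∧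
        IsLandau138W L (m + 1) η (Ω 0) (Λs (m + 1)) U₀ (mgauge U₀ v⁻¹ U₁) ∧ Restr129 L (m + 1) (Λs (m + 1)) U₀ (u₁ * v)))
    (SH59Dβ : ∀ α₀ α₁ : ℝ, 0 < α₀ → 0 < α₁ → α₀ + α₁ ≤ cP →
      ∀ U₀ U' : Site d → Fin d → 𝔸ˣ, (∀ x κ, U₀ x κ ∈ unitaryUnits 𝔸) → (∀ x κ, U' x κ ∈ unitaryUnits 𝔸) →
      InAk L k η α₀ Ω U₀ → InAk L k η α₀ Ω (mulCfg U' U₀) → (∀ m, m ≤ k → InAx L m (Λs m) U₀ (mulCfg U' U₀)) →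
      (∀ j, j ≤ k → ∀ (z : Site d) (μ : Fin d), (∀ x, InBox (loK L j z) (bondHiK L j z μ) x → x ∈ Ω j) →
        ‖(avgIter L (mulCfg U' U₀) j z μ : 𝔸) - (avgIter L U₀ j z μ : 𝔸)‖ ≤ α₁) →
      (∀ b ∈ {b : Site d × Fin d | SideTouches (Ω 0) b.1 b.2}, ‖((U' b.1 b.2 : 𝔸ˣ) : 𝔸) - 1‖ ≤ α₁) →
      (∀ m, 1 ≤ m → m ≤ k → ∀ (u : Site d → 𝔸ˣ) (W : Site d → Fin d → 𝔸ˣ) (A' : Site d → Fin d → 𝔸),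
        (∀ x, u x ∈ unitaryUnits 𝔸) → (∀ x, x ∉ Ω 0 → u x = 1) → mgauge U₀ u W = U' → Restr129 L m (Λs m) U₀ u →
        IsLandau138W L m η (Ω 0) (Λs m) U₀ W → (∀ y τ, IsSelfAdjoint (A' y τ)) →
        (∀ j, j ≤ m → ∀ y τ, SideTouches (Ω j) y τ →
        W y τ = cfgExp η A' y τ ∧ ‖A' y τ‖ ≤ (2 * (L * (5 * (d : ℝ) * L * B₀ * (α₀ + α₁))) + 8 * (8 * B₀' * (5 * (d : ℝ) * L * B₀) * (α₀ + α₁))) * ((L : ℝ) ^ j * η)⁻¹) →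
        (∀ y τ, (∀ j, j ≤ m → ¬ SideTouches (Ω j) y τ) → A' y τ = 0) →
        msup L m η (-(1 : ℝ)) (fun j (b : Site d × Fin d) => SideTouches (Ω j) b.1 b.2) (fun b => A' b.1 b.2)
        ≤ B₀ * (bondNorm L m η (-(3 : ℝ)) Ω (fun x μ => Jcur η U₀ A' μ x)
        + wsup 1 (fun p : {p : ℕ × (Site d × Fin d) // p.1 ≤ m ∧ (p.2 ∈ Λb m p.1 ∨ (p.1 = 0 ∧ CrossB (Ω 0) p.2))} =>
        linCovIter L U₀ (iEta η A') p.1.1 p.1.2.1 p.1.2.2))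
        + Bbd * msup L m η (-(1 : ℝ)) (fun j (b : Site d × Fin d) => j = 0 ∧ SideTouches (Ω 0) b.1 b.2 ∧ ¬ BondTouches (Ω 0) b.1 b.2)
            (fun b => A' b.1 b.2) ∧
        msup L m η (-(2 : ℝ)) (fun j (t : Fin d × Fin d × Site d) => SideTouches (Ω j) t.2.2 t.2.1)
        (fun t => covDerivFwd η U₀ t.1 (fun z => A' z t.2.1) t.2.2)
        ≤ B₀ * (bondNorm L m η (-(3 : ℝ)) Ω (fun x μ => Jcur η U₀ A' μ x)
        + wsup 1 (fun p : {p : ℕ × (Site d × Fin d) // p.1 ≤ m ∧ (p.2 ∈ Λb m p.1 ∨ (p.1 = 0 ∧ CrossB (Ω 0) p.2))} =>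
        linCovIter L U₀ (iEta η A') p.1.1 p.1.2.1 p.1.2.2))
        + Bbd * msup L m η (-(1 : ℝ)) (fun j (b : Site d × Fin d) => j = 0 ∧ SideTouches (Ω 0) b.1 b.2 ∧ ¬ BondTouches (Ω 0) b.1 b.2)
            (fun b => A' b.1 b.2)))
    (SP5u : ∀ α₀ α₁ : ℝ, 0 < α₀ → 0 < α₁ → α₀ + α₁ ≤ cP →
      ∀ U₀ U' : Site d → Fin d → 𝔸ˣ, (∀ x κ, U₀ x κ ∈ unitaryUnits 𝔸) → (∀ x κ, U' x κ ∈ unitaryUnits 𝔸) →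
      InAk L k η α₀ Ω U₀ → InAk L k η α₀ Ω (mulCfg U' U₀) → (∀ m, m ≤ k → InAx L m (Λs m) U₀ (mulCfg U' U₀)) →
      (∀ j, j ≤ k → ∀ (z : Site d) (μ : Fin d), (∀ x, InBox (loK L j z) (bondHiK L j z μ) x → x ∈ Ω j) →
        ‖(avgIter L (mulCfg U' U₀) j z μ : 𝔸) - (avgIter L U₀ j z μ : 𝔸)‖ ≤ α₁) →
      (∀ b ∈ {b : Site d × Fin d | SideTouches (Ω 0) b.1 b.2}, ‖((U' b.1 b.2 : 𝔸ˣ) : 𝔸) - 1‖ ≤ α₁) →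
      ∀ u₁ : Site d → 𝔸ˣ, (∀ x, u₁ x ∈ unitaryUnits 𝔸) → Restr129 L k (Λs k) U₀ u₁ →
      ∀ (v w : Site d → 𝔸ˣ) (lam mu : Site d → 𝔸),
      (∀ j, j ≤ k → ∀ y ∈ Λs k j, ∀ x : Site d, InBox (tlo L y j) (thi L y j) x →
        ((gaugeExp lam x : 𝔸ˣ) : 𝔸) = ((v x : 𝔸ˣ) : 𝔸) ∧ IsSelfAdjoint (lam x) ∧ ‖lam x‖ < cu ∧
          ∀ κ : Fin d, InBox (tlo L y j) (thi L y j) (x + e κ) → ((L : ℝ) ^ j * η) * ‖covDerivFwd η U₀ κ lam x‖ < cu) →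
      (∀ j, j ≤ k → ∀ y ∈ Λs k j, ∀ x : Site d, InBox (tlo L y j) (thi L y j) x →
        ((gaugeExp mu x : 𝔸ˣ) : 𝔸) = ((w x : 𝔸ˣ) : 𝔸) ∧ IsSelfAdjoint (mu x) ∧ ‖mu x‖ < cu ∧
          ∀ κ : Fin d, InBox (tlo L y j) (thi L y j) (x + e κ) → ((L : ℝ) ^ j * η) * ‖covDerivFwd η U₀ κ mu x‖ < cu) →
      IsLandau138W L k η (Ω 0) (Λs k) U₀ (mgauge U₀ v⁻¹ (mgauge U₀ u₁⁻¹ U')) → Restr129 L k (Λs k) U₀ (u₁ * v) →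
      IsLandau138W L k η (Ω 0) (Λs k) U₀ (mgauge U₀ w⁻¹ (mgauge U₀ u₁⁻¹ U')) → Restr129 L k (Λs k) U₀ (u₁ * w) →
      ∀ j, j ≤ k → ∀ y ∈ Λs k j, ∀ x : Site d, InBox (tlo L y j) (thi L y j) x → v x = w x),
      ∀ α₀ α₁ : ℝ, 0 < α₀ → 0 < α₁ → α₀ + α₁ ≤ c₁ →
      ∀ U₀ U' : Site d → Fin d → 𝔸ˣ, (∀ x κ, U₀ x κ ∈ unitaryUnits 𝔸) → (∀ x κ, U' x κ ∈ unitaryUnits 𝔸) →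
      InAk L k η α₀ Ω U₀ → InAk L k η α₀ Ω (mulCfg U' U₀) → (∀ m, m ≤ k → InAx L m (Λs m) U₀ (mulCfg U' U₀)) →
      -- (1.35) for the datum in PRINT's class: every level-`j` bond whose box lies in `Ω_{j−1}` (p. 77 «at least one end-point in Ω»)
      (∀ j, j ≤ k → ∀ (z : Site d) (μ : Fin d), (∀ x, InBox (loK L j z) (bondHiK L j z μ) x → x ∈ Ω (j - 1)) →
        ‖(avgIter L (mulCfg U' U₀) j z μ : 𝔸) - (avgIter L U₀ j z μ : 𝔸)‖ ≤ α₁) →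
      (∀ b ∈ {b : Site d × Fin d | SideTouches (Ω 0) b.1 b.2}, ‖((U' b.1 b.2 : 𝔸ˣ) : 𝔸) - 1‖ ≤ α₁) →
      ∃ u : Site d → 𝔸ˣ, (∀ x, u x ∈ unitaryUnits 𝔸) ∧ (∀ x, x ∉ Ω 0 → u x = 1) ∧ Restr129 L k (Λs k) U₀ u ∧
        (1 ≤ k → IsLandau138W L k η (Ω 0) (Λs k) U₀ (mgauge U₀ u⁻¹ U')) ∧
        (∀ j, j ≤ k → ∀ b ∈ {b : Site d × Fin d | SideTouches (Ω j) b.1 b.2},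
          mgauge U₀ u⁻¹ U' b.1 b.2 = cfgExp η (logCfg η (mgauge U₀ u⁻¹ U')) b.1 b.2 ∧
            IsSelfAdjoint (logCfg η (mgauge U₀ u⁻¹ U') b.1 b.2) ∧
            ‖logCfg η (mgauge U₀ u⁻¹ U') b.1 b.2‖ ≤ (5 * (d : ℝ) * L * B₀ * (α₀ + α₁)) * ((L : ℝ) ^ j * η)⁻¹) ∧
        ∀ u' : Site d → 𝔸ˣ, (∀ x, u' x ∈ unitaryUnits 𝔸) → (∀ x, x ∉ Ω 0 → u' x = 1) → Restr129 L k (Λs k) U₀ u' →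
          IsLandau138W L k η (Ω 0) (Λs k) U₀ (mgauge U₀ u'⁻¹ U') →
          (∃ A' : Site d → Fin d → 𝔸, ∀ j, j ≤ k → ∀ (x : Site d) (κ : Fin d), SideTouches (Ω j) x κ →
            mgauge U₀ u'⁻¹ U' x κ = cfgExp η A' x κ ∧ ‖A' x κ‖ ≤ (5 * (d : ℝ) * L * B₀ * (α₀ + α₁)) * ((L : ℝ) ^ j * η)⁻¹) →
          (1 ≤ k) → u' = u := by
  have hL1 : 1 ≤ L := le_trans (by norm_num) hL
  have hd1 : 1 ≤ d := le_trans (by norm_num) hd2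
  have hd' : (1 : ℝ) ≤ d := by exact_mod_cast hd1
  have hL' : (1 : ℝ) ≤ L := by exact_mod_cast hL1
  obtain ⟨cγ, hcγ, Hγ⟩ := thm4Exists_concrete_uniform_γ (𝔸 := 𝔸) hd2 hL hB₀ hB₀' hB hcP hBbd hBd
  obtain ⟨c₁, hc₁, hw⟩ := thm4_windows hd1 hL1 hB₀ hB₀' hB
  obtain ⟨c₂, hc₂, hw'⟩ := thm4_windows_extra (d := d) hL1
  -- the threshold for Proposition 5's uniqueness radius: `2000·d·c⋆ ≤ cu`
  obtain ⟨c₃, hc₃def⟩ : ∃ c₃ : ℝ, c₃ = cu / (2000 * d * (5 * d * L * B₀)) := ⟨_, rfl⟩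
  have hc₃ : 0 < c₃ := by rw [hc₃def]; positivity
  refine ⟨min cγ (min (min c₁ c₂) (min cP c₃)), lt_min hcγ (lt_min (lt_min hc₁ hc₂) (lt_min hcP hc₃)), ?_⟩
  intro η hη k Ω hΩ Λs Λb hbox hclass htower hpart hlay SP5base SP5 SH59Dβ SP5u α₀ α₁ hα₀ hα₁ hS U₀ U' hU₀ hU' h33 h34 hAx h135 h66
  have hSγ : α₀ + α₁ ≤ cγ := hS.trans (min_le_left _ _)
  have hS' : α₀ + α₁ ≤ min (min c₁ c₂) (min cP c₃) := hS.trans (min_le_right _ _)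
  have hS1 : α₀ + α₁ ≤ c₁ := hS'.trans ((min_le_left _ _).trans (min_le_left _ _))
  have hS2 : α₀ + α₁ ≤ c₂ := hS'.trans ((min_le_left _ _).trans (min_le_right _ _))
  have hSP : α₀ + α₁ ≤ cP := hS'.trans ((min_le_right _ _).trans (min_le_left _ _))
  have hS3 : α₀ + α₁ ≤ c₃ := hS'.trans ((min_le_right _ _).trans (min_le_right _ _))
  obtain ⟨w1, w2, w3, w4, w5, w6, w7, w8, w9, w10, w11, w12, w13, w14, w15, w16, w17, w18⟩ :=
    hw α₀ α₁ hα₀ hα₁ hS1 (5 * (d : ℝ) * L * B₀ * (α₀ + α₁)) (8 * B₀' * (5 * (d : ℝ) * L * B₀) * (α₀ + α₁)) rfl rfl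
  obtain ⟨w19, w20⟩ := hw' α₀ α₁ hα₀ hα₁ hS2
  -- the old-guard (1.35) for Proposition 5's uniqueness socket: boxes in `Ω_j` lie in `Ω_{j−1}`
  have hΩp : ∀ j, Ω j ⊆ Ω (j - 1) := by
    intro j x hx
    rcases Nat.eq_zero_or_pos j with rfl | hjp
    · simpa using hx
    · obtain ⟨i, rfl⟩ : ∃ i, j = i + 1 := ⟨j - 1, by omega⟩
      rw [Nat.add_sub_cancel]; exact hΩ i hx
  have h135o : ∀ j, j ≤ k → ∀ (z : Site d) (μ : Fin d), (∀ x, InBox (loK L j z) (bondHiK L j z μ) x → x ∈ Ω j) →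
      ‖(avgIter L (mulCfg U' U₀) j z μ : 𝔸) - (avgIter L U₀ j z μ : 𝔸)‖ ≤ α₁ :=
    fun j hj z μ hg => h135 j hj z μ fun x hx => hΩp j (hg x hx)
  have hcs0 : 0 ≤ 5 * (d : ℝ) * L * B₀ * (α₀ + α₁) := by positivity
  -- EXISTENCE: dag-n05-e's γ assembly, by name
  obtain ⟨u, hu, huS, h129, hLan, hleaf⟩ :=
    Hγ η hη k Ω hΩ Λs Λb hbox hclass hlay SP5base SP5 SH59Dβ α₀ α₁ hα₀ hα₁ hSγ U₀ U' hU₀ hU' h33 h34 hAx h135 h66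
  refine ⟨u, hu, huS, h129, hLan, hleaf, ?_⟩
  -- UNIQUENESS: any other restricted u′ with (1.38) and the (1.62)-shape equals u (β tail verbatim)
  intro u' hu' hu'S h129' hLan' h162' hk1
  have hk_Lan : IsLandau138W L k η (Ω 0) (Λs k) U₀ (mgauge U₀ u⁻¹ U') := hLan hk1
  have h162 : ∃ A₂ : Site d → Fin d → 𝔸, ∀ j, j ≤ k → ∀ (x : Site d) (κ : Fin d), SideTouches (Ω j) x κ →
      mgauge U₀ u⁻¹ U' x κ = cfgExp η A₂ x κ ∧ ‖A₂ x κ‖ ≤ (5 * (d : ℝ) * L * B₀ * (α₀ + α₁)) * ((L : ℝ) ^ j * η)⁻¹ :=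
    ⟨logCfg η (mgauge U₀ u⁻¹ U'), fun j hj x κ hxκ => ⟨(hleaf j hj (x, κ) hxκ).1, (hleaf j hj (x, κ) hxκ).2.2⟩⟩
  -- the windows of the uniqueness clause at `c := c⋆`, `α_P := α₀`, and Prop. 5's radius `cu`
  obtain ⟨cs, hcsdef⟩ : ∃ cs : ℝ, cs = 5 * (d : ℝ) * L * B₀ * (α₀ + α₁) := ⟨_, rfl⟩
  have hcs0' : 0 ≤ cs := by rw [hcsdef]; positivity
  have h2000 : 2000 * (d : ℝ) * cs ≤ cu := by
    have hden : 0 < 2000 * (d : ℝ) * (5 * d * L * B₀) := by positivity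
    have h := (le_div_iff₀ hden).1 (hS3.trans (le_of_eq hc₃def))
    have e : 2000 * (d : ℝ) * cs = (α₀ + α₁) * (2000 * d * (5 * d * L * B₀)) := by rw [hcsdef]; ring
    linarith
  have hcu₂ : 5 * cs < cu := by
    have h₁ : (1 : ℝ) * cs ≤ d * cs := mul_le_mul_of_nonneg_right hd' hcs0'
    have hdcs : 0 ≤ (d : ℝ) * cs := by positivity
    linarith
  have hcu₁ : 2 * (2 * (40 * d * cs) + 2 * 1116 * (40 * d * cs) ^ 2) < cu := by
    have hx0 : 0 ≤ 40 * d * cs := by positivity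
    have hx1 : 40 * d * cs ≤ 1 / 5000 := by rw [hcsdef]; exact w16
    have hsq : (40 * d * cs) ^ 2 ≤ 40 * d * cs * (1 / 5000) := by rw [sq]; exact mul_le_mul_of_nonneg_left hx1 hx0
    have hdcs : 0 ≤ (d : ℝ) * cs := by positivity
    linarith
  rw [hcsdef] at hcu₁ hcu₂
  exact thm4_unique_eq_landau138 hd2 hL hη hU₀ hU' hu' hu hα₀ w5 w6 hcs0 w18 w17 w15 w16 hα₀ w5 w20 hcu₁ hcu₂ h33
    (by rw [← mulCfg_eq_mul]; exact h34) (by rw [← mulCfg_eq_mul]; exact hAx k le_rfl) htower h129' h129 hLan' hk_Lan h162' h162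
    (SP5u α₀ α₁ hα₀ hα₁ hSP U₀ U' hU₀ hU' h33 h34 hAx h135o h66 u' hu' h129') hpart hu'S huS

end Main

#print axioms thm4Body_concrete_uniform_γ

/-! ## §2 (v1.1) The member sentence and the printed sentence on the re-typed carrier `zdGF3P` (print's classes) -/

section Member

variable {𝔸 : Type} [CStarAlgebra 𝔸] [Nontrivial 𝔸]

/-- ★ **`B8.Thm4Body (5dL·K·B₀)` AT ONE MEMBER OF THE RE-TYPED CARRIER `zdGF3P`, EDITION γ** (Theorem 4, p. 88; `K = 26384(d+1)L`): §1's
`thm4Body_concrete_uniform_γ` at the member with the class `Λb := towerBondsP L i.Ω (i.Λs ·) ·` (laws `B8TowerBondsPrinted.ZdIdx.towerBondsP_laws`), run at the SCALED pair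
`(K·α₀, K·α₁)`: the member's one-end-point letter `avgClose166` ⇒ the box-form letter (`inBox_bondBox_of_inBox_block_fst`) ⇒ the γ driver's «box ⊂ Ω_{j−1}» datum at `K·α₁`
(`B8Ineq166OneLevelUp.avgClose_predBox_of_boxForm`), (1.33)∕(1.34) at `K·α₀` (`inAk_mono_alpha`), (1.66)₀ weakened; threshold `c₁∕K` plus the bridge's windows; whence (1.29), (1.38)
and the (1.62)-shape at `5dLB₀(Kα₀ + Kα₁) = 5dL(KB₀)(α₀ + α₁)`.  (1.37) `C137 α₁` ON PRINT's CLASS AT PRINT's `α₁` by `B8Eq142KLevelLocalGammaPrime.H42_of_inAx_γ'` fed by the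
member's letter VERBATIM (tower law `ZdIdx.htower`, windows `thm4_windows_γ` at the scaled pair + `dLα₁ ≤ 1∕8` of `thm4_windows_extra`); uniqueness = §1's clause at the scaled
datum (`ring`).  Hypotheses per member = the boundary-layer law `hlay` + the four sockets at `B₀` (`SockP5base` ∕ `SockP5` ∕ the β-shaped (1.59) socket over
print's class ∕ `SockP5u`).
[cite: Balaban1985RegularSpaces, Thm 4 p.88 («B′₁ = C′₁B₁»), (1.29) p.81, (1.31) p.82, (1.35)∕(1.37)–(1.38) p.82, (1.42) p.83, (1.58)–(1.62) pp.86–87, (1.66) p.87, Prop. 5 (1.107)–(1.109) p.94, p.95, p.77] -/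
theorem thm4Body_member_zd3P_γ (hd2 : 2 ≤ d) {L : ℕ} (hL : 2 ≤ L) (β : ℝ) (len : Site d → ℝ) {B₀ B₀' cu cP Bbd : ℝ} (hB₀ : 0 < B₀)
    (hB₀' : 0 < B₀') (hB : 2 ≤ 5 * (d : ℝ) * L * B₀) (hcu : 0 < cu) (hcP : 0 < cP) (hBbd : 0 ≤ Bbd) (hBd : 4 * Bbd ≤ ((d : ℝ) * L - 1) * B₀) :
    ∃ c₁ : ℝ, 0 < c₁ ∧ ∀ i : ZdIdx d L,
      -- the boundary-layer law of the member: a site of `Ω₀` with a sup-distance-1 neighbour outside `Ω₀` lies in `Λs m 0`, `1 ≤ m ≤ k`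
      (∀ m, 1 ≤ m → m ≤ i.k → ∀ y z : Site d, y ∈ i.Ω 0 → z ∉ i.Ω 0 → (∀ l, y l - 1 ≤ z l ∧ z l ≤ y l + 1) → y ∈ i.Λs m 0) →
      SockP5base (𝔸 := 𝔸) L B₀ B₀' cP i.η i.k i.Ω i.Λs → SockP5 (𝔸 := 𝔸) L B₀ B₀' cP i.η i.k i.Ω i.Λs →
      -- the β-shaped (1.59) socket over PRINT's class `towerBondsP L i.Ω (i.Λs m) ·` of the member's tower (support clause; collar term `Bbd`)
      (∀ α₀ α₁ : ℝ, 0 < α₀ → 0 < α₁ → α₀ + α₁ ≤ cP →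
        ∀ U₀ U' : Site d → Fin d → 𝔸ˣ, (∀ x κ, U₀ x κ ∈ unitaryUnits 𝔸) → (∀ x κ, U' x κ ∈ unitaryUnits 𝔸) →
        InAk L i.k i.η α₀ i.Ω U₀ → InAk L i.k i.η α₀ i.Ω (mulCfg U' U₀) → (∀ m, m ≤ i.k → InAx L m (i.Λs m) U₀ (mulCfg U' U₀)) →
        (∀ j, j ≤ i.k → ∀ (z : Site d) (μ : Fin d), (∀ x, InBox (loK L j z) (bondHiK L j z μ) x → x ∈ i.Ω j) →
          ‖(avgIter L (mulCfg U' U₀) j z μ : 𝔸) - (avgIter L U₀ j z μ : 𝔸)‖ ≤ α₁) →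
        (∀ b ∈ {b : Site d × Fin d | SideTouches (i.Ω 0) b.1 b.2}, ‖((U' b.1 b.2 : 𝔸ˣ) : 𝔸) - 1‖ ≤ α₁) →
        (∀ m, 1 ≤ m → m ≤ i.k → ∀ (u : Site d → 𝔸ˣ) (W : Site d → Fin d → 𝔸ˣ) (A' : Site d → Fin d → 𝔸),
          (∀ x, u x ∈ unitaryUnits 𝔸) → (∀ x, x ∉ i.Ω 0 → u x = 1) → mgauge U₀ u W = U' → Restr129 L m (i.Λs m) U₀ u →
          IsLandau138W L m i.η (i.Ω 0) (i.Λs m) U₀ W → (∀ y τ, IsSelfAdjoint (A' y τ)) →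
          (∀ j, j ≤ m → ∀ y τ, SideTouches (i.Ω j) y τ →
          W y τ = cfgExp i.η A' y τ ∧ ‖A' y τ‖ ≤ (2 * (L * (5 * (d : ℝ) * L * B₀ * (α₀ + α₁))) + 8 * (8 * B₀' * (5 * (d : ℝ) * L * B₀) * (α₀ + α₁))) * ((L : ℝ) ^ j * i.η)⁻¹) →
          (∀ y τ, (∀ j, j ≤ m → ¬ SideTouches (i.Ω j) y τ) → A' y τ = 0) →
          msup L m i.η (-(1 : ℝ)) (fun j (b : Site d × Fin d) => SideTouches (i.Ω j) b.1 b.2) (fun b => A' b.1 b.2)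
          ≤ B₀ * (bondNorm L m i.η (-(3 : ℝ)) i.Ω (fun x μ => Jcur i.η U₀ A' μ x)
          + wsup 1 (fun p : {p : ℕ × (Site d × Fin d) // p.1 ≤ m ∧ (p.2 ∈ towerBondsP L i.Ω (i.Λs m) p.1 ∨ (p.1 = 0 ∧ CrossB (i.Ω 0) p.2))} =>
          linCovIter L U₀ (iEta i.η A') p.1.1 p.1.2.1 p.1.2.2))
          + Bbd * msup L m i.η (-(1 : ℝ)) (fun j (b : Site d × Fin d) => j = 0 ∧ SideTouches (i.Ω 0) b.1 b.2 ∧ ¬ BondTouches (i.Ω 0) b.1 b.2)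
              (fun b => A' b.1 b.2) ∧
          msup L m i.η (-(2 : ℝ)) (fun j (t : Fin d × Fin d × Site d) => SideTouches (i.Ω j) t.2.2 t.2.1)
          (fun t => covDerivFwd i.η U₀ t.1 (fun z => A' z t.2.1) t.2.2)
          ≤ B₀ * (bondNorm L m i.η (-(3 : ℝ)) i.Ω (fun x μ => Jcur i.η U₀ A' μ x)
          + wsup 1 (fun p : {p : ℕ × (Site d × Fin d) // p.1 ≤ m ∧ (p.2 ∈ towerBondsP L i.Ω (i.Λs m) p.1 ∨ (p.1 = 0 ∧ CrossB (i.Ω 0) p.2))} =>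
          linCovIter L U₀ (iEta i.η A') p.1.1 p.1.2.1 p.1.2.2))
          + Bbd * msup L m i.η (-(1 : ℝ)) (fun j (b : Site d × Fin d) => j = 0 ∧ SideTouches (i.Ω 0) b.1 b.2 ∧ ¬ BondTouches (i.Ω 0) b.1 b.2)
              (fun b => A' b.1 b.2))) →
      SockP5u (𝔸 := 𝔸) L cP cu i.η i.k i.Ω i.Λs →
      B8.Thm4Body c₁ (5 * (d : ℝ) * L * (26384 * ((d : ℝ) + 1) * L * B₀)) (fun _ : Unit => (zdGF3P 𝔸 L β len i).toGFData) := by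
  have hL1 : 1 ≤ L := le_trans (by norm_num) hL
  have hd1 : 1 ≤ d := le_trans (by norm_num) hd2
  have hL' : (1 : ℝ) ≤ L := by exact_mod_cast hL1
  have hd' : (1 : ℝ) ≤ d := by exact_mod_cast hd1
  have hd0 : (0 : ℝ) ≤ d := Nat.cast_nonneg d
  -- the bridge constant `K = 26384(d+1)L ≥ 2`
  have hK1 : (2 : ℝ) ≤ 26384 * ((d : ℝ) + 1) * L := by
    have h1 : (26384 : ℝ) * ((d : ℝ) + 1) * 1 ≤ 26384 * ((d : ℝ) + 1) * L :=
      mul_le_mul_of_nonneg_left hL' (by positivity)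
    nlinarith [h1, hd0]
  have hK0 : (0 : ℝ) < 26384 * ((d : ℝ) + 1) * L := by positivity
  have hK1' : (1 : ℝ) ≤ (26384 * ((d : ℝ) + 1) * L) := by linarith
  have hKle : ∀ t : ℝ, 0 ≤ t → t ≤ (26384 * ((d : ℝ) + 1) * L) * t := fun t ht => le_mul_of_one_le_left ht hK1'
  obtain ⟨c₁, hc₁, H⟩ := thm4Body_concrete_uniform_γ (𝔸 := 𝔸) hd2 hL hB₀ hB₀' hB hcu hcP hBbd hBd
  obtain ⟨cw, hcw, hw⟩ := thm4_windows_γ hd1 hL1 hB₀ hB₀' hB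
  obtain ⟨cw', hcw', hw'⟩ := thm4_windows_extra (d := d) hL1
  have hcb : (0 : ℝ) < 1 / (12288 * ((d : ℝ) + 1) * L) := by positivity
  refine ⟨min (c₁ / (26384 * ((d : ℝ) + 1) * L)) (min (cw / (26384 * ((d : ℝ) + 1) * L)) (min cw' (1 / (12288 * ((d : ℝ) + 1) * L)))),
    lt_min (div_pos hc₁ hK0) (lt_min (div_pos hcw hK0) (lt_min hcw' hcb)), ?_⟩
  intro i hlay SP5base SP5 SH59Dβ SP5u _ α₀ α₁ hα₀ hα₁ hs U₀ P hInA _ hInAAx h166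
  have hs₁ : α₀ + α₁ ≤ c₁ / (26384 * ((d : ℝ) + 1) * L) := hs.trans (min_le_left _ _)
  have hsw : α₀ + α₁ ≤ cw / (26384 * ((d : ℝ) + 1) * L) := hs.trans ((min_le_right _ _).trans (min_le_left _ _))
  have hsw' : α₀ + α₁ ≤ cw' := hs.trans ((min_le_right _ _).trans ((min_le_right _ _).trans (min_le_left _ _)))
  have hsb : α₀ + α₁ ≤ 1 / (12288 * ((d : ℝ) + 1) * L) :=
    hs.trans ((min_le_right _ _).trans ((min_le_right _ _).trans (min_le_right _ _)))
  have hsK1 : (26384 * ((d : ℝ) + 1) * L) * α₀ + (26384 * ((d : ℝ) + 1) * L) * α₁ ≤ c₁ := by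
    have h := (le_div_iff₀ hK0).1 hs₁
    have e : (α₀ + α₁) * (26384 * ((d : ℝ) + 1) * L) = (26384 * ((d : ℝ) + 1) * L) * α₀ + (26384 * ((d : ℝ) + 1) * L) * α₁ := by ring
    linarith [h, e]
  have hswK : (26384 * ((d : ℝ) + 1) * L) * α₀ + (26384 * ((d : ℝ) + 1) * L) * α₁ ≤ cw := by
    have h := (le_div_iff₀ hK0).1 hsw
    have e : (α₀ + α₁) * (26384 * ((d : ℝ) + 1) * L) = (26384 * ((d : ℝ) + 1) * L) * α₀ + (26384 * ((d : ℝ) + 1) * L) * α₁ := by ring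
    linarith [h, e]
  have hα₁w : α₁ ≤ 1 / (12288 * ((d : ℝ) + 1) * L) := by linarith
  obtain ⟨hP1, h34, hAx⟩ := hInAAx
  obtain ⟨h135, h66⟩ := h166
  subst hP1
  have hα₀' : 0 < (26384 * ((d : ℝ) + 1) * L) * α₀ := mul_pos hK0 hα₀
  have hα₁' : 0 < (26384 * ((d : ℝ) + 1) * L) * α₁ := mul_pos hK0 hα₁
  -- the γ windows at the SCALED pair `(Kα₀, Kα₁)`, the `dLα₁ ≤ 1/8` window at the original pair
  obtain ⟨g5, g6, g7, g9, g10, -, -⟩ :=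
    hw ((26384 * ((d : ℝ) + 1) * L) * α₀) ((26384 * ((d : ℝ) + 1) * L) * α₁) hα₀' hα₁' hswK (5 * (d : ℝ) * L * B₀ * ((26384 * ((d : ℝ) + 1) * L) * α₀ + (26384 * ((d : ℝ) + 1) * L) * α₁))
      (8 * B₀' * (5 * (d : ℝ) * L * B₀) * ((26384 * ((d : ℝ) + 1) * L) * α₀ + (26384 * ((d : ℝ) + 1) * L) * α₁)) rfl rfl
  obtain ⟨w19, -⟩ := hw' α₀ α₁ hα₀ hα₁ hsw'
  -- the bridge's own windows at the ORIGINAL `α₀`: `C₀α₀ ≤ 1/3`, `8α₀ ≤ c₂′` (from the scaled γ windows, `α₀ ≤ L²·Kα₀`)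
  have hL2 : (1 : ℝ) ≤ (L : ℝ) ^ 2 := one_le_pow₀ hL'
  have hαup : α₀ ≤ (L : ℝ) ^ 2 * ((26384 * ((d : ℝ) + 1) * L) * α₀) :=
    (hKle α₀ hα₀.le).trans (le_mul_of_one_le_left hα₀'.le hL2)
  have hα3 : C0 d * α₀ ≤ 1 / 3 := (mul_le_mul_of_nonneg_left hαup (C0_pos d).le).trans g5
  have hα8 : 8 * α₀ ≤ c2' d L := by
    have h2 : 2 * α₀ ≤ (26384 * ((d : ℝ) + 1) * L) * α₀ := mul_le_mul_of_nonneg_right hK1 hα₀.le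
    have h3 : (26384 * ((d : ℝ) + 1) * L) * α₀ ≤ (L : ℝ) ^ 2 * ((26384 * ((d : ℝ) + 1) * L) * α₀) := le_mul_of_one_le_left hα₀'.le hL2
    have h1 : 8 * α₀ ≤ 4 * ((L : ℝ) ^ 2 * ((26384 * ((d : ℝ) + 1) * L) * α₀)) := by linarith
    exact h1.trans g6
  -- the box-form letter follows from the one-end-point letter (both end-blocks inside ⇒ the first is)
  have h135box : ∀ j, j ≤ i.k → ∀ (z : Site d) (μ : Fin d), (∀ x, InBox (loK L j z) (bondHiK L j z μ) x → x ∈ i.Ω j) →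
      ‖(avgIter L (mulCfg P.2.1 P.1.1) j z μ : 𝔸) - (avgIter L P.1.1 j z μ : 𝔸)‖ ≤ α₁ :=
    fun j hj z μ hg => h135 j hj z μ (Or.inl fun x hx => hg x (B8Ineq165AllLevels.inBox_bondBox_of_inBox_block_fst L j z μ hx))
  -- the γ-guard letter at `K·α₁` by the one-level-up bridge (this seat's p584176)
  have h135γ := avgClose_predBox_of_boxForm (U := mulCfg P.2.1 P.1.1) hL P.1.2 hα₀ hα3 hα8 hα₁.le hα₁w hInA h135box
  -- the scaled (1.33)/(1.34)/(1.66)₀ data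
  have h33' : InAk L i.k i.η ((26384 * ((d : ℝ) + 1) * L) * α₀) i.Ω P.1.1 := inAk_mono_alpha i.hη (hKle α₀ hα₀.le) hInA
  have h34' : InAk L i.k i.η ((26384 * ((d : ℝ) + 1) * L) * α₀) i.Ω (mulCfg P.2.1 P.1.1) := inAk_mono_alpha i.hη (hKle α₀ hα₀.le) h34
  have h66' : ∀ b ∈ {b : Site d × Fin d | SideTouches (i.Ω 0) b.1 b.2}, ‖((P.2.1 b.1 b.2 : 𝔸ˣ) : 𝔸) - 1‖ ≤ (26384 * ((d : ℝ) + 1) * L) * α₁ :=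
    fun b hb => (h66 b hb).trans (hKle α₁ hα₁.le)
  -- print's class of the member's tower obeys the γ driver's laws (dag-n05-d's D0)
  obtain ⟨hboxP, hclassP⟩ := B8TowerBondsPrinted.ZdIdx.towerBondsP_laws i
  obtain ⟨u, hu, huS, h129, hLan, hleaf, huniq⟩ := H i.η i.hη i.k i.Ω i.hΩ i.Λs (fun m j => towerBondsP L i.Ω (i.Λs m) j)
    hboxP hclassP i.htower i.hpart hlay SP5base SP5 SH59Dβ SP5u ((26384 * ((d : ℝ) + 1) * L) * α₀) ((26384 * ((d : ℝ) + 1) * L) * α₁) hα₀' hα₁' hsK1 P.1.1 P.2.1 P.1.2 P.2.2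
    h33' h34' hAx h135γ h66'
  have hcs0 : 0 ≤ 5 * (d : ℝ) * L * B₀ * ((26384 * ((d : ℝ) + 1) * L) * α₀ + (26384 * ((d : ℝ) + 1) * L) * α₁) := by positivity
  have hKS0 : 0 ≤ 2 * (L * (5 * (d : ℝ) * L * B₀ * ((26384 * ((d : ℝ) + 1) * L) * α₀ + (26384 * ((d : ℝ) + 1) * L) * α₁))) + 8 * (8 * B₀' * (5 * (d : ℝ) * L * B₀) * ((26384 * ((d : ℝ) + 1) * L) * α₀ + (26384 * ((d : ℝ) + 1) * L) * α₁)) := by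
    positivity
  have hcK : 5 * (d : ℝ) * L * B₀ * ((26384 * ((d : ℝ) + 1) * L) * α₀ + (26384 * ((d : ℝ) + 1) * L) * α₁) ≤
      2 * (L * (5 * (d : ℝ) * L * B₀ * ((26384 * ((d : ℝ) + 1) * L) * α₀ + (26384 * ((d : ℝ) + 1) * L) * α₁))) + 8 * (8 * B₀' * (5 * (d : ℝ) * L * B₀) * ((26384 * ((d : ℝ) + 1) * L) * α₀ + (26384 * ((d : ℝ) + 1) * L) * α₁)) := by
    have h₁ : (1 : ℝ) * (5 * (d : ℝ) * L * B₀ * ((26384 * ((d : ℝ) + 1) * L) * α₀ + (26384 * ((d : ℝ) + 1) * L) * α₁)) ≤ L * (5 * (d : ℝ) * L * B₀ * ((26384 * ((d : ℝ) + 1) * L) * α₀ + (26384 * ((d : ℝ) + 1) * L) * α₁)) :=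
      mul_le_mul_of_nonneg_right hL' hcs0
    have h₂ : 0 ≤ 8 * (8 * B₀' * (5 * (d : ℝ) * L * B₀) * ((26384 * ((d : ℝ) + 1) * L) * α₀ + (26384 * ((d : ℝ) + 1) * L) * α₁)) := by positivity
    linarith
  have h16KS : 16 * (2 * (L * (5 * (d : ℝ) * L * B₀ * ((26384 * ((d : ℝ) + 1) * L) * α₀ + (26384 * ((d : ℝ) + 1) * L) * α₁))) + 8 * (8 * B₀' * (5 * (d : ℝ) * L * B₀) * ((26384 * ((d : ℝ) + 1) * L) * α₀ + (26384 * ((d : ℝ) + 1) * L) * α₁))) ≤ 1 := by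
    have h₁ : (1 : ℝ) * (2 * (L * (5 * (d : ℝ) * L * B₀ * ((26384 * ((d : ℝ) + 1) * L) * α₀ + (26384 * ((d : ℝ) + 1) * L) * α₁))) + 8 * (8 * B₀' * (5 * (d : ℝ) * L * B₀) * ((26384 * ((d : ℝ) + 1) * L) * α₀ + (26384 * ((d : ℝ) + 1) * L) * α₁))) ≤
        L * (2 * (L * (5 * (d : ℝ) * L * B₀ * ((26384 * ((d : ℝ) + 1) * L) * α₀ + (26384 * ((d : ℝ) + 1) * L) * α₁))) + 8 * (8 * B₀' * (5 * (d : ℝ) * L * B₀) * ((26384 * ((d : ℝ) + 1) * L) * α₀ + (26384 * ((d : ℝ) + 1) * L) * α₁))) :=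
      mul_le_mul_of_nonneg_right hL' hKS0
    linarith
  have hc16 : 16 * (5 * (d : ℝ) * L * B₀ * ((26384 * ((d : ℝ) + 1) * L) * α₀ + (26384 * ((d : ℝ) + 1) * L) * α₁)) ≤ 1 := by linarith
  -- the gauge-fixed field and its CANONICAL masked exponent
  have hW : mgauge P.1.1 u (mgauge P.1.1 u⁻¹ P.2.1) = P.2.1 := mgauge_mgauge_inv P.1.1 P.2.1 u
  have hWu : ∀ x κ, mgauge P.1.1 u⁻¹ P.2.1 x κ ∈ unitaryUnits 𝔸 := mem_unitaryUnits_of_mgauge_eq P.1.2 P.2.2 hu hW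
  have hWA : ∀ j, j ≤ i.k → ∀ y τ, SideTouches (i.Ω j) y τ →
      mgauge P.1.1 u⁻¹ P.2.1 y τ = cfgExp i.η (logCfg i.η (mgauge P.1.1 u⁻¹ P.2.1)) y τ ∧
        ‖logCfg i.η (mgauge P.1.1 u⁻¹ P.2.1) y τ‖ ≤ (5 * (d : ℝ) * L * B₀ * ((26384 * ((d : ℝ) + 1) * L) * α₀ + (26384 * ((d : ℝ) + 1) * L) * α₁)) * ((L : ℝ) ^ j * i.η)⁻¹ :=
    fun j hj y τ h => ⟨(hleaf j hj (y, τ) h).1, (hleaf j hj (y, τ) h).2.2⟩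
  obtain ⟨hA'sa, hA'eq, hA'zero⟩ := mlogCfg_spec i.hη hL1 i.k P.1.1 hWu hcs0 hc16 i.Ω hWA
  set A' := mlogCfg i.k i.η i.Ω (mgauge P.1.1 u⁻¹ P.2.1) with hA'_def
  have hA'bd : ∀ j, j ≤ i.k → ∀ y τ, SideTouches (i.Ω j) y τ →
      mgauge P.1.1 u⁻¹ P.2.1 y τ = cfgExp i.η A' y τ ∧
        ‖A' y τ‖ ≤ (2 * (L * (5 * (d : ℝ) * L * B₀ * ((26384 * ((d : ℝ) + 1) * L) * α₀ + (26384 * ((d : ℝ) + 1) * L) * α₁))) + 8 * (8 * B₀' * (5 * (d : ℝ) * L * B₀) * ((26384 * ((d : ℝ) + 1) * L) * α₀ + (26384 * ((d : ℝ) + 1) * L) * α₁))) *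
          ((L : ℝ) ^ j * i.η)⁻¹ := by
    intro j hj y τ h
    obtain ⟨hAA, hWexp⟩ := hA'eq j hj y τ h
    refine ⟨hWexp, ?_⟩
    rw [hAA]
    have hη0 : 0 ≤ i.η := i.hη.le
    exact ((hWA j hj y τ h).2).trans (mul_le_mul_of_nonneg_right hcK (by positivity))
  -- (1.37) ON PRINT's CLASS at PRINT's α₁: the γ′ (1.42) lemma fed by the member's one-end-point letter itself (no bridge there)
  have h137 := B8Eq142KLevelLocalGammaPrime.H42_of_inAx_γ' hd2 i.hη hL i.k P.1.2 hα₀' hα₁ hKS0 g5 g6 g7 g9 g10 w19 i.Ω i.hΩ i.Λs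
    (fun m j => towerBondsP L i.Ω (i.Λs m) j) hboxP hclassP h33' h34' hAx (fun j hj z μ hg => h135 j hj z μ hg)
    (fun m W => IsLandau138W L m i.η (i.Ω 0) (i.Λs m) P.1.1 W) i.k i.hk le_rfl i.htower u
    (mgauge P.1.1 u⁻¹ P.2.1) A' hu hW h129 (hLan i.hk) hA'sa hA'bd hA'zero
  refine ⟨⟨u, hu, huS⟩, h129, ⟨h137, hLan i.hk, ?_⟩, ?_⟩
  · intro j hj b hb
    obtain ⟨h1, h2, h3⟩ := hleaf j hj b hb
    exact ⟨h1, h2, h3.trans (le_of_eq (by ring))⟩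
  · intro u' hR' _ hLan' h162'
    apply Subtype.ext
    refine huniq u'.1 u'.2.1 u'.2.2 hR' hLan' ⟨logCfg i.η (mgauge P.1.1 u'.1⁻¹ P.2.1), fun j hj x κ h => ?_⟩ i.hk
    exact ⟨(h162' j hj (x, κ) h).1, ((h162' j hj (x, κ) h).2.2).trans (le_of_eq (by ring))⟩

/-- ★★ **`B8.Thm4Printed (5dL·K·B₀)` ON AN INDEX-MAPPED SUB-FAMILY `zdGF3P ∘ ι` OF THE RE-TYPED CARRIER, EDITION γ** (`ι : J → ZdIdx d L`; e.g. the record's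
sub-index once NODE 00 re-pins to `zdGF3P`): Theorem 4 AS PRINTED — (1.35)∕(1.66) and (1.37) over print's classes — from the four sockets on the image of `ι` (the
β-shaped (1.59) socket over print's class `towerBondsP`, i.e. the shape dag-n06-b's γ suppliers deliver) and the members' boundary-layer law (`hlay`; void at `Ω₀ = ℤᵈ`).
[cite: Balaban1985RegularSpaces, Thm 4 p.88 («there exists a constant c₁ … exactly one»), Prop. 5 p.94, (1.59) p.86, (1.31) p.82] -/
theorem thm4Printed_zd3P_map_γ (hd2 : 2 ≤ d) {L : ℕ} (hL : 2 ≤ L) {β : ℝ} {len : Site d → ℝ} {B₀ B₀' cu cP Bbd : ℝ} (hB₀ : 0 < B₀)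
    (hB₀' : 0 < B₀') (hB : 2 ≤ 5 * (d : ℝ) * L * B₀) (hcu : 0 < cu) (hcP : 0 < cP) (hBbd : 0 ≤ Bbd) (hBd : 4 * Bbd ≤ ((d : ℝ) * L - 1) * B₀)
    {J : Type} (ι : J → ZdIdx d L)
    (hlay : ∀ j : J, ∀ m, 1 ≤ m → m ≤ (ι j).k → ∀ y z : Site d, y ∈ (ι j).Ω 0 → z ∉ (ι j).Ω 0 →
      (∀ l, y l - 1 ≤ z l ∧ z l ≤ y l + 1) → y ∈ (ι j).Λs m 0)
    (SP5base : ∀ j : J, SockP5base (𝔸 := 𝔸) L B₀ B₀' cP (ι j).η (ι j).k (ι j).Ω (ι j).Λs)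
    (SP5 : ∀ j : J, SockP5 (𝔸 := 𝔸) L B₀ B₀' cP (ι j).η (ι j).k (ι j).Ω (ι j).Λs)
    (SH59Dβ : ∀ j : J, ∀ α₀ α₁ : ℝ, 0 < α₀ → 0 < α₁ → α₀ + α₁ ≤ cP →
        ∀ U₀ U' : Site d → Fin d → 𝔸ˣ, (∀ x κ, U₀ x κ ∈ unitaryUnits 𝔸) → (∀ x κ, U' x κ ∈ unitaryUnits 𝔸) →
        InAk L (ι j).k (ι j).η α₀ (ι j).Ω U₀ → InAk L (ι j).k (ι j).η α₀ (ι j).Ω (mulCfg U' U₀) →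
        (∀ m, m ≤ (ι j).k → InAx L m ((ι j).Λs m) U₀ (mulCfg U' U₀)) →
        (∀ j', j' ≤ (ι j).k → ∀ (z : Site d) (μ : Fin d), (∀ x, InBox (loK L j' z) (bondHiK L j' z μ) x → x ∈ (ι j).Ω j') →
          ‖(avgIter L (mulCfg U' U₀) j' z μ : 𝔸) - (avgIter L U₀ j' z μ : 𝔸)‖ ≤ α₁) →
        (∀ b ∈ {b : Site d × Fin d | SideTouches ((ι j).Ω 0) b.1 b.2}, ‖((U' b.1 b.2 : 𝔸ˣ) : 𝔸) - 1‖ ≤ α₁) →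
        (∀ m, 1 ≤ m → m ≤ (ι j).k → ∀ (u : Site d → 𝔸ˣ) (W : Site d → Fin d → 𝔸ˣ) (A' : Site d → Fin d → 𝔸),
          (∀ x, u x ∈ unitaryUnits 𝔸) → (∀ x, x ∉ (ι j).Ω 0 → u x = 1) → mgauge U₀ u W = U' → Restr129 L m ((ι j).Λs m) U₀ u →
          IsLandau138W L m (ι j).η ((ι j).Ω 0) ((ι j).Λs m) U₀ W → (∀ y τ, IsSelfAdjoint (A' y τ)) →
          (∀ j', j' ≤ m → ∀ y τ, SideTouches ((ι j).Ω j') y τ →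
          W y τ = cfgExp (ι j).η A' y τ ∧ ‖A' y τ‖ ≤ (2 * (L * (5 * (d : ℝ) * L * B₀ * (α₀ + α₁))) + 8 * (8 * B₀' * (5 * (d : ℝ) * L * B₀) * (α₀ + α₁))) * ((L : ℝ) ^ j' * (ι j).η)⁻¹) →
          (∀ y τ, (∀ j', j' ≤ m → ¬ SideTouches ((ι j).Ω j') y τ) → A' y τ = 0) →
          msup L m (ι j).η (-(1 : ℝ)) (fun j' (b : Site d × Fin d) => SideTouches ((ι j).Ω j') b.1 b.2) (fun b => A' b.1 b.2)
          ≤ B₀ * (bondNorm L m (ι j).η (-(3 : ℝ)) (ι j).Ω (fun x μ => Jcur (ι j).η U₀ A' μ x)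
          + wsup 1 (fun p : {p : ℕ × (Site d × Fin d) // p.1 ≤ m ∧ (p.2 ∈ towerBondsP L (ι j).Ω ((ι j).Λs m) p.1 ∨ (p.1 = 0 ∧ CrossB ((ι j).Ω 0) p.2))} =>
          linCovIter L U₀ (iEta (ι j).η A') p.1.1 p.1.2.1 p.1.2.2))
          + Bbd * msup L m (ι j).η (-(1 : ℝ)) (fun j' (b : Site d × Fin d) => j' = 0 ∧ SideTouches ((ι j).Ω 0) b.1 b.2 ∧ ¬ BondTouches ((ι j).Ω 0) b.1 b.2)
              (fun b => A' b.1 b.2) ∧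
          msup L m (ι j).η (-(2 : ℝ)) (fun j' (t : Fin d × Fin d × Site d) => SideTouches ((ι j).Ω j') t.2.2 t.2.1)
          (fun t => covDerivFwd (ι j).η U₀ t.1 (fun z => A' z t.2.1) t.2.2)
          ≤ B₀ * (bondNorm L m (ι j).η (-(3 : ℝ)) (ι j).Ω (fun x μ => Jcur (ι j).η U₀ A' μ x)
          + wsup 1 (fun p : {p : ℕ × (Site d × Fin d) // p.1 ≤ m ∧ (p.2 ∈ towerBondsP L (ι j).Ω ((ι j).Λs m) p.1 ∨ (p.1 = 0 ∧ CrossB ((ι j).Ω 0) p.2))} =>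
          linCovIter L U₀ (iEta (ι j).η A') p.1.1 p.1.2.1 p.1.2.2))
          + Bbd * msup L m (ι j).η (-(1 : ℝ)) (fun j' (b : Site d × Fin d) => j' = 0 ∧ SideTouches ((ι j).Ω 0) b.1 b.2 ∧ ¬ BondTouches ((ι j).Ω 0) b.1 b.2)
              (fun b => A' b.1 b.2)))
    (SP5u : ∀ j : J, SockP5u (𝔸 := 𝔸) L cP cu (ι j).η (ι j).k (ι j).Ω (ι j).Λs) :
    B8.Thm4Printed (5 * (d : ℝ) * L * (26384 * ((d : ℝ) + 1) * L * B₀)) (fun j : J => (zdGF3P 𝔸 L β len (ι j)).toGFData) := by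
  obtain ⟨c₁, hc₁, H⟩ := thm4Body_member_zd3P_γ (𝔸 := 𝔸) hd2 hL β len hB₀ hB₀' hB hcu hcP hBbd hBd
  exact ⟨c₁, hc₁, fun j => H (ι j) (hlay j) (SP5base j) (SP5 j) (SH59Dβ j) (SP5u j) ()⟩



/-- ★★ **The same on the record's H-twin `zdGF3HP`** (Theorem 8's source space as printed; its `GFData` part IS `zdGF3P`'s by `rfl`,
`B8LeafModelZd3P.zdGF3HP_toGFData`) — the form NODE 00's re-pinned slot `famB8OfRecordSubBP := zdGF3HP ∘ …` reads.
[cite: Balaban1985RegularSpaces, Thm 4 p.88, Thm 8 (1.146) p.101 (bookkeeping)] -/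
theorem thm4Printed_zd3HP_map_γ (hd2 : 2 ≤ d) {L : ℕ} (hL : 2 ≤ L) {β : ℝ} {len : Site d → ℝ} {B₀ B₀' cu cP Bbd : ℝ} (hB₀ : 0 < B₀)
    (hB₀' : 0 < B₀') (hB : 2 ≤ 5 * (d : ℝ) * L * B₀) (hcu : 0 < cu) (hcP : 0 < cP) (hBbd : 0 ≤ Bbd) (hBd : 4 * Bbd ≤ ((d : ℝ) * L - 1) * B₀)
    {J : Type} (ι : J → ZdIdx d L)
    (hlay : ∀ j : J, ∀ m, 1 ≤ m → m ≤ (ι j).k → ∀ y z : Site d, y ∈ (ι j).Ω 0 → z ∉ (ι j).Ω 0 →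
      (∀ l, y l - 1 ≤ z l ∧ z l ≤ y l + 1) → y ∈ (ι j).Λs m 0)
    (SP5base : ∀ j : J, SockP5base (𝔸 := 𝔸) L B₀ B₀' cP (ι j).η (ι j).k (ι j).Ω (ι j).Λs)
    (SP5 : ∀ j : J, SockP5 (𝔸 := 𝔸) L B₀ B₀' cP (ι j).η (ι j).k (ι j).Ω (ι j).Λs)
    (SH59Dβ : ∀ j : J, ∀ α₀ α₁ : ℝ, 0 < α₀ → 0 < α₁ → α₀ + α₁ ≤ cP →
        ∀ U₀ U' : Site d → Fin d → 𝔸ˣ, (∀ x κ, U₀ x κ ∈ unitaryUnits 𝔸) → (∀ x κ, U' x κ ∈ unitaryUnits 𝔸) →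
        InAk L (ι j).k (ι j).η α₀ (ι j).Ω U₀ → InAk L (ι j).k (ι j).η α₀ (ι j).Ω (mulCfg U' U₀) →
        (∀ m, m ≤ (ι j).k → InAx L m ((ι j).Λs m) U₀ (mulCfg U' U₀)) →
        (∀ j', j' ≤ (ι j).k → ∀ (z : Site d) (μ : Fin d), (∀ x, InBox (loK L j' z) (bondHiK L j' z μ) x → x ∈ (ι j).Ω j') →
          ‖(avgIter L (mulCfg U' U₀) j' z μ : 𝔸) - (avgIter L U₀ j' z μ : 𝔸)‖ ≤ α₁) →
        (∀ b ∈ {b : Site d × Fin d | SideTouches ((ι j).Ω 0) b.1 b.2}, ‖((U' b.1 b.2 : 𝔸ˣ) : 𝔸) - 1‖ ≤ α₁) →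
        (∀ m, 1 ≤ m → m ≤ (ι j).k → ∀ (u : Site d → 𝔸ˣ) (W : Site d → Fin d → 𝔸ˣ) (A' : Site d → Fin d → 𝔸),
          (∀ x, u x ∈ unitaryUnits 𝔸) → (∀ x, x ∉ (ι j).Ω 0 → u x = 1) → mgauge U₀ u W = U' → Restr129 L m ((ι j).Λs m) U₀ u →
          IsLandau138W L m (ι j).η ((ι j).Ω 0) ((ι j).Λs m) U₀ W → (∀ y τ, IsSelfAdjoint (A' y τ)) →
          (∀ j', j' ≤ m → ∀ y τ, SideTouches ((ι j).Ω j') y τ →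
          W y τ = cfgExp (ι j).η A' y τ ∧ ‖A' y τ‖ ≤ (2 * (L * (5 * (d : ℝ) * L * B₀ * (α₀ + α₁))) + 8 * (8 * B₀' * (5 * (d : ℝ) * L * B₀) * (α₀ + α₁))) * ((L : ℝ) ^ j' * (ι j).η)⁻¹) →
          (∀ y τ, (∀ j', j' ≤ m → ¬ SideTouches ((ι j).Ω j') y τ) → A' y τ = 0) →
          msup L m (ι j).η (-(1 : ℝ)) (fun j' (b : Site d × Fin d) => SideTouches ((ι j).Ω j') b.1 b.2) (fun b => A' b.1 b.2)
          ≤ B₀ * (bondNorm L m (ι j).η (-(3 : ℝ)) (ι j).Ω (fun x μ => Jcur (ι j).η U₀ A' μ x)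
          + wsup 1 (fun p : {p : ℕ × (Site d × Fin d) // p.1 ≤ m ∧ (p.2 ∈ towerBondsP L (ι j).Ω ((ι j).Λs m) p.1 ∨ (p.1 = 0 ∧ CrossB ((ι j).Ω 0) p.2))} =>
          linCovIter L U₀ (iEta (ι j).η A') p.1.1 p.1.2.1 p.1.2.2))
          + Bbd * msup L m (ι j).η (-(1 : ℝ)) (fun j' (b : Site d × Fin d) => j' = 0 ∧ SideTouches ((ι j).Ω 0) b.1 b.2 ∧ ¬ BondTouches ((ι j).Ω 0) b.1 b.2)
              (fun b => A' b.1 b.2) ∧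
          msup L m (ι j).η (-(2 : ℝ)) (fun j' (t : Fin d × Fin d × Site d) => SideTouches ((ι j).Ω j') t.2.2 t.2.1)
          (fun t => covDerivFwd (ι j).η U₀ t.1 (fun z => A' z t.2.1) t.2.2)
          ≤ B₀ * (bondNorm L m (ι j).η (-(3 : ℝ)) (ι j).Ω (fun x μ => Jcur (ι j).η U₀ A' μ x)
          + wsup 1 (fun p : {p : ℕ × (Site d × Fin d) // p.1 ≤ m ∧ (p.2 ∈ towerBondsP L (ι j).Ω ((ι j).Λs m) p.1 ∨ (p.1 = 0 ∧ CrossB ((ι j).Ω 0) p.2))} =>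
          linCovIter L U₀ (iEta (ι j).η A') p.1.1 p.1.2.1 p.1.2.2))
          + Bbd * msup L m (ι j).η (-(1 : ℝ)) (fun j' (b : Site d × Fin d) => j' = 0 ∧ SideTouches ((ι j).Ω 0) b.1 b.2 ∧ ¬ BondTouches ((ι j).Ω 0) b.1 b.2)
              (fun b => A' b.1 b.2)))
    (SP5u : ∀ j : J, SockP5u (𝔸 := 𝔸) L cP cu (ι j).η (ι j).k (ι j).Ω (ι j).Λs) :
    B8.Thm4Printed (5 * (d : ℝ) * L * (26384 * ((d : ℝ) + 1) * L * B₀)) (fun j : J => (zdGF3HP 𝔸 L β len (ι j)).toGFData) :=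
  thm4Printed_zd3P_map_γ (𝔸 := 𝔸) hd2 hL hB₀ hB₀' hB hcu hcP hBbd hBd ι hlay SP5base SP5 SH59Dβ SP5u

end Member

#print axioms thm4Body_member_zd3P_γ
#print axioms thm4Printed_zd3P_map_γ
#print axioms thm4Printed_zd3HP_map_γ

end Literature.MathematicalPhysics.QuantumFieldTheory.Balaban1983to89.B8Thm4Zd3Gamma

end
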